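import Mathlib.MeasureTheory.Measure.MeasureSpaceDef
import Mathlib.Analysis.SpecialFunctions.Log.Basic
import Mathlib.Algebra.BigOperators.Finprod
import Mathlib.Algebra.BigOperators.Field
import Mathlib.Topology.Sets.Compacts
import Mathlib.Algebra.Module.Submodule.Basic
import Mathlib.Tactic.FieldSimp
import Mathlib.Tactic.Ring
import HarnessLib

/-!
# [IUTchIII] Proposition 3.9: log-volume for packets and processions; Remarks 3.9.1–3.9.3,
# 3.9.6, 3.9.7 (abc-iut cell, layer L6, slice [IUTchIII] §3)

S. Mochizuki, *Inter-universal Teichmüller theory III*, kurims manuscript (May 2020) of PRIMS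
**57** (2021), §3: Proposition 3.9 "(Log-volume for Packets and Processions)" pp. 115–118,
Remark 3.9.1 pp. 118–119, Remark 3.9.2 p. 119, Remark 3.9.3 pp. 119–120, Remark 3.9.6 p. 145,
Remark 3.9.7 pp. 145–147 (PRIMS offset ≈ +420). These are the log-volume normalisations quoted
by Corollary 3.12 ("procession-normalized mono-analytic log-volume … cf. Proposition 3.9, (i),
(ii)"). STATEMENTS-FIRST typing:

* (i) The packet log-volume on DIRECT PRODUCT REGIONS of a tensor packet `𝓘^ℚ((−)) ≅ ⊕_i k_i`
  (direct sum of `p_{v_ℚ}`-adic fields resp. complex archimedean fields, Proposition 3.1 (i)) is a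
  REAL definition, `packetLogVolume w μ (Π_i S_i) = Σ_i w_i · log μ_i(S_i)`, with the weights `w_i` of
  Remark 3.1.1 (ii) (`PacketWeights.lean`: `packetWeight`, `packetWeightTensor`; passed here as a
  parameter so that this file imports Mathlib only) and Haar measures `μ_i` normalised by
  `μ_i(𝒪_{k_i}) = 1`; the two printed properties — "the log-volume of each of the 'local holomorphic'
  integral structures … is equal to zero" and the **packet-normalization** "multiplication … by
  `p_v` corresponds to adding the quantity `−log(p_v)`" — are PROVED from the corresponding
  properties of the summands and the weight normalisation (`packetLogVolume_integralStructure`,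
  `packetLogVolume_packetNormalized`). General compact open regions are handled by the
  `E`-weighted measure of Remark 3.1.1 (iv) (`PacketWeights.lean`) and Remark 3.9.7 (ii) (infimum
  over covering regions, `logVolumeOfRelCompact` below). The **procession-normalization** (average
  over `j ∈ {1, …, l^⋇}`) is `processionNormalized`; Remark 3.9.3 (equal weights are forced) is
  PROVED in its typed form.
* (ii) mono-analytic compatibility, (iii) the global log-volume (REAL: a finitely supported sum over
  `v_ℚ ∈ 𝕍_ℚ`, `globalLogVolume`) with its two printed properties as named `Prop`s, (iv) log-link
  compatibility (a), (b) as named `Prop`s over abstract data.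
* Remark 3.9.1 (i): the mono-analytic shells `𝓘_i = (p*_{v_ℚ})^{-1} · log_{k_i}(𝒪^×_{k_i})` are
  `nonarchLogShell` of `LocalLogShells.lean` (abc-iut-L6-t3) — not redeclared; (ii) (a), (b) (the factor `2` between the tensor-product and
  direct-sum Hermitian metrics under `ℂ ⊗_ℝ ℂ ≅ ℂ ⊕ ℂ`) PROVED in concrete form for the CRT map on
  the standard basis (the "any isomorphism" clause: TODO(general form), classification of
  continuous ring automorphisms of `ℂ × ℂ`); (iii) is a pointer to [IUTchIV] §1. Remarks 3.9.2, 3.9.6, 3.9.7 typed as indicated at each declaration.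
Tag form [claim: Mochizuki2012, status: disputed] (D-0012 claim key).
-/

namespace Literature.IUT.LogThetaLattice

open MeasureTheory Finset

universe u v

/-! ### Proposition 3.9 (i): packet-normalized log-volumes on direct product regions -/

section PacketLogVolume

variable {ι : Type u} [Fintype ι] {k : ι → Type v} [∀ i, MeasurableSpace (k i)]

/-- The **packet log-volume** of a direct product region `Π_i S_i ⊆ 𝓘^ℚ((−)) ≅ ⊕_i k_i` ([IUTchIII]
Proposition 3.9 (i), p. 115: "the `p_{v_ℚ}`-adic log-volume on each of the direct summand
`p_{v_ℚ}`-adic fields … together with the … normalized weights in Remark 3.1.1, (ii), (iii), (iv) —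
determines log-volumes `μ^log_{α,v_ℚ} : 𝕄(𝓘^ℚ(^α𝓕_{v_ℚ})) → ℝ`, `μ^log_{A,v_ℚ}`, `μ^log_{A,α,v}`"; likewise
at archimedean `v_ℚ` with radial log-volumes, p. 116): `Σ_i w_i · log μ_i(S_i)`, where `μ_i` is the
Haar measure of the summand `k_i` with `μ_i(𝒪_{k_i}) = 1` ([AbsTopIII] Prop. 5.7 (i)) and `w_i` the
normalized weight of the summand (`packetWeight` / `packetWeightTensor` of `PacketWeights.lean`).
This is the direct-product-region case of Remark 3.1.1 (iii)/(iv) ("completely straightforward").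
[claim: Mochizuki2012, status: disputed] -/
noncomputable def packetLogVolume (w : ι → ℝ) (μ : ∀ i, Measure (k i)) (T : ∀ i, Set (k i)) : ℝ :=
  ∑ i, w i * Real.log (μ i (T i)).toReal

/-- [IUTchIII] Proposition 3.9 (i), p. 115/116: "the log-volume of each of the 'local holomorphic'
integral structures of Proposition 3.1, (ii) — i.e., the elements `𝒪_{^α𝓕_{v_ℚ}} ⊆ 𝓘^ℚ(^α𝓕_{v_ℚ})`;
`𝒪_{^A𝓕_{v_ℚ}}`; `𝒪_{^{A,α}𝓕_v}` … given by the [products of the] integral structures … on each of the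
direct summand[s] — is equal to zero". PROVED from the summand normalisation `μ_i(𝒪_{k_i}) = 1`.
[claim: Mochizuki2012, status: disputed] -/
theorem packetLogVolume_integralStructure (w : ι → ℝ) (μ : ∀ i, Measure (k i))
    (O : ∀ i, Set (k i)) (hO : ∀ i, μ i (O i) = 1) : packetLogVolume w μ O = 0 := by
  simp [packetLogVolume, hO]

/-- **Packet-normalization** ([IUTchIII] Proposition 3.9 (i), p. 115: "we assume that these
log-volumes are normalized so that multiplication of an element of `𝕄(−)` by `p_v` corresponds to
adding the quantity `−log(p_v) ∈ ℝ`; we shall refer to this normalization as the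
packet-normalization"). PROVED: if multiplication by `p` scales the Haar measure of the summand
`k_i` by `p^{-d_i}` (`d_i = [k_i : ℚ_p]`) and the weights satisfy `Σ_i w_i d_i = 1` (the
normalisation of Remark 3.1.1 (ii), `packetWeight_normalized`), then the packet log-volume drops by
exactly `log p`. [claim: Mochizuki2012, status: disputed] -/
theorem packetLogVolume_packetNormalized (w : ι → ℝ) (μ : ∀ i, Measure (k i)) (d : ι → ℕ)
    (p : ℝ) (hp : 0 < p) (hw : ∑ i, w i * d i = 1) (T pT : ∀ i, Set (k i))
    (hT : ∀ i, (μ i (T i)).toReal ≠ 0)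
    (hscale : ∀ i, (μ i (pT i)).toReal = p⁻¹ ^ d i * (μ i (T i)).toReal) :
    packetLogVolume w μ pT = packetLogVolume w μ T - Real.log p := by
  simp only [packetLogVolume]
  have h : ∀ i, w i * Real.log (μ i (pT i)).toReal
      = w i * Real.log (μ i (T i)).toReal - (w i * d i) * Real.log p := by
    intro i
    rw [hscale i, Real.log_mul (pow_ne_zero _ (inv_ne_zero hp.ne')) (hT i), Real.log_pow,
      Real.log_inv]
    ring
  simp_rw [h, Finset.sum_sub_distrib, ← Finset.sum_mul, hw, one_mul]

/-- Archimedean **packet-normalization** ([IUTchIII] Proposition 3.9 (i), p. 116: "normalized so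
that multiplication of an element of `𝕄(−)` by `e = 2.71828…` corresponds to adding the quantity
`1 = log(e) ∈ ℝ`"). PROVED in the same form: if multiplication by `e` scales the radial measure of
the summand `k_i` by `e^{d_i}` and `Σ_i w_i d_i = 1`, the packet log-volume increases by `1`.
[claim: Mochizuki2012, status: disputed] -/
theorem packetLogVolume_packetNormalized_arch (w : ι → ℝ) (μ : ∀ i, Measure (k i)) (d : ι → ℕ)
    (hw : ∑ i, w i * d i = 1) (T eT : ∀ i, Set (k i)) (hT : ∀ i, (μ i (T i)).toReal ≠ 0)
    (hscale : ∀ i, (μ i (eT i)).toReal = Real.exp 1 ^ d i * (μ i (T i)).toReal) :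
    packetLogVolume w μ eT = packetLogVolume w μ T + 1 := by
  simp only [packetLogVolume]
  have h : ∀ i, w i * Real.log (μ i (eT i)).toReal
      = w i * Real.log (μ i (T i)).toReal + (w i * d i) := by
    intro i
    rw [hscale i, Real.log_mul (pow_ne_zero _ (Real.exp_pos 1).ne') (hT i), Real.log_pow,
      Real.log_exp]
    ring
  simp_rw [h, Finset.sum_add_distrib, hw]

/-- [IUTchIII] Proposition 3.9 (i), p. 116: "`μ^log_{A,v_ℚ}` is invariant with respect to
permutations of `A`" — typed for the direct-product-region log-volume: invariance of the weighted
sum under a simultaneous re-indexing of weights, measures and regions by a permutation of the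
summand index (the permutation of `A` acts on the collections `{v_α}`). PROVED (re-indexing a
finite sum). [claim: Mochizuki2012, status: disputed] -/
theorem packetLogVolume_perm (w : ι → ℝ) (μ : ∀ i, Measure (k i)) (T : ∀ i, Set (k i))
    (σ : Equiv.Perm ι) :
    ∑ i, w (σ i) * Real.log (μ (σ i) (T (σ i))).toReal = packetLogVolume w μ T :=
  Equiv.sum_comp σ (fun i => w i * Real.log (μ i (T i)).toReal)

end PacketLogVolume

/-! ### Proposition 3.9 (i), (ii): procession-normalization; Remark 3.9.3 -/

section Procession

/-- **Procession-normalization** ([IUTchIII] Proposition 3.9 (i), p. 116: "when working with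
collections of capsules in a procession, as in Proposition 3.4, (ii), we obtain … log-volumes on the
products of the '𝕄(−)' associated to the various capsules …, which we normalize by taking the
average, over the various capsules"; the capsules are indexed by `j ∈ {1, …, l^⋇} = 𝔽_l^⋇`, cf.
Corollary 3.12 "the average is taken over `j ∈ 𝔽_l^⋇`"). [claim: Mochizuki2012, status: disputed] -/
noncomputable def processionNormalized {lstar : ℕ} (vol : Fin lstar → ℝ) : ℝ :=
  (∑ j, vol j) / lstar

/-- The procession-normalized log-volume of a constant family is that constant (`l^⋇ ≥ 1`).
[claim: Mochizuki2012, status: disputed] -/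
theorem processionNormalized_const {lstar : ℕ} (h : 0 < lstar) (c : ℝ) :
    processionNormalized (fun _ : Fin lstar => c) = c := by
  have : (lstar : ℝ) ≠ 0 := by exact_mod_cast h.ne'
  simp [processionNormalized, Finset.sum_const, Finset.card_univ, Fintype.card_fin]
  field_simp

/-- [IUTchIII] Remark 3.9.3, pp. 119–120: "Is it possible to work with more general weighted
averages …? The answer … is 'no'": since the packet-normalized log-volume of the capsule with index
set `S^±_{j+1}` "may be thought of as a log-volume that arises from 'any one of the log-shells whose
label `∈ {0, 1, …, j}`'", compatibility with the inclusions of the procession forces, for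
`j' ≤ j₁, j₂`, "the same weights [for] `S^±_{j₁+1}`, `S^±_{j₂+1}`". Typed: a weight vector on capsules
such that any two capsules containing a common label carry the same weight is constant — PROVED
(every capsule contains the label `0`). [claim: Mochizuki2012, status: disputed] -/
theorem Remark393_equalWeights {lstar : ℕ} (c : Fin lstar → ℝ)
    (h : ∀ (j' : ℕ) (j₁ j₂ : Fin lstar), j' ≤ j₁ → j' ≤ j₂ → c j₁ = c j₂) (j₁ j₂ : Fin lstar) :
    c j₁ = c j₂ :=
  h 0 j₁ j₂ (Nat.zero_le _) (Nat.zero_le _)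

/-- [IUTchIII] Proposition 3.9 (ii) "(Mono-analytic Compatibility)", p. 116, typed over abstract
data: the mono-analytic log-volume `μD` on regions of `𝓘^ℚ(^α𝒟^⊢_{v_ℚ})` (constructed from the
`𝒟^⊢`-prime-strips by "a functorial algorithm", adjusting for the discrepancy of integral structures,
Remark 3.9.1) is "compatible with the log-volumes obtained in (i), relative to the natural
poly-isomorphisms of Proposition 3.2, (i)": for every member `e` of the poly-isomorphism,
`μD(S) = μF(e(S))`; and likewise for the procession-normalized versions and for "`𝓕^{⊢×μ}`" in place
of "`𝒟^⊢`". [claim: Mochizuki2012, status: disputed] -/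
def Prop39ii_monoAnalyticCompat {XD XF : Type u} (poly : Set (XD ≃ XF)) (μD : Set XD → ℝ)
    (μF : Set XF → ℝ) : Prop :=
  ∀ e ∈ poly, ∀ S : Set XD, μD S = μF (e '' S)

end Procession

/-! ### Proposition 3.9 (iii): global log-volumes -/

section Global

variable {VQ : Type u} {Region : VQ → Type v}

/-- `𝕄(𝓘^ℚ(^A𝓕_{𝕍_ℚ})) ⊆ Π_{v_ℚ ∈ 𝕍_ℚ} 𝕄(𝓘^ℚ(^A𝓕_{v_ℚ}))`: "the subset of elements whose components, indexed
by `v_ℚ ∈ 𝕍_ℚ`, have zero log-volume for all but finitely many `v_ℚ`" ([IUTchIII] Proposition 3.9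
(iii), p. 117). [claim: Mochizuki2012, status: disputed] -/
def GlobalRegion (μlog : ∀ vQ, Region vQ → ℝ) : Type _ :=
  {S : ∀ vQ, Region vQ // (Function.support fun vQ => μlog vQ (S vQ)).Finite}

/-- The **global log-volume** `μ^log_{A,𝕍_ℚ} : 𝕄(𝓘^ℚ(^A𝓕_{𝕍_ℚ})) → ℝ`, "by adding the log-volumes of (i)
[all but finitely many of which are zero!] at the various `v_ℚ ∈ 𝕍_ℚ`" ([IUTchIII] Proposition 3.9
(iii), p. 117). [claim: Mochizuki2012, status: disputed] -/
noncomputable def globalLogVolume (μlog : ∀ vQ, Region vQ → ℝ) (S : GlobalRegion μlog) : ℝ :=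
  ∑ᶠ vQ, μlog vQ (S.1 vQ)

/-- [IUTchIII] Proposition 3.9 (iii), p. 117: the global log-volume "is invariant with respect to
multiplication by elements of `(†𝕄⊛_mod)_α = (†𝕄⊛_MOD)_α ⊆ 𝓘^ℚ(^A𝓕_{𝕍_ℚ})`" (a product formula), typed over
an abstract action `act` of the nonzero elements `F` of the number field on global regions.
[claim: Mochizuki2012, status: disputed] -/
def Prop39iii_invariance {F : Type*} (μlog : ∀ vQ, Region vQ → ℝ)
    (act : F → GlobalRegion μlog → GlobalRegion μlog) : Prop :=
  ∀ (f : F) (S : GlobalRegion μlog), globalLogVolume μlog (act f S) = globalLogVolume μlog S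

/-- [IUTchIII] Proposition 3.9 (iii), p. 117: for objects `𝔍 = {𝔍_v}_{v∈𝕍}` of `(†𝓕⊛_𝔪𝔬𝔡)_α` (Example 3.6
(ii); Proposition 3.7 (ii)), "the global log-volume `μ^log_{A,𝕍_ℚ}(𝔍)` is equal to the degree of the
arithmetic line bundle determined by `𝔍` …, relative to a suitable normalization" — typed over
abstract data: the region `regionOf 𝔍` attached to an object and the arithmetic degree `deg`, with
the normalization an unspecified positive constant. [claim: Mochizuki2012, status: disputed] -/
def Prop39iii_degree {Obj : Type*} (μlog : ∀ vQ, Region vQ → ℝ)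
    (regionOf : Obj → GlobalRegion μlog) (deg : Obj → ℝ) : Prop :=
  ∃ c : ℝ, 0 < c ∧ ∀ J : Obj, globalLogVolume μlog (regionOf J) = c * deg J

/-- [IUTchIII] Proposition 3.9 (iv) "(log-link Compatibility)", (a), p. 117: for an LGP-Gaussian
log-theta-lattice, "the log-volumes constructed in (i), (ii), (iii) … determine log-volumes on the
various '`𝓘^ℚ((−))`' that appear in the construction of the local/global LGP-, lgp-monoids/Frobenioids
… in the `𝓕^⊩`-prime-strips `^{n,m}𝔉^⊩_LGP`, `^{n,m}𝔉^⊩_lgp` … relative to the log-link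
`^{n,m-1}𝓗𝓣 →^{log} ^{n,m}𝓗𝓣`" — typed as the datum of a log-volume on the regions of each `𝓘^ℚ`
indexed by `(n, m)`. [claim: Mochizuki2012, status: disputed] -/
def Prop39iv_a (X : ℤ → ℤ → Type u) : Type u := ∀ n m, Set (X n m) → ℝ

/-- [IUTchIII] Proposition 3.9 (iv) (b), p. 117: "At the level of the `ℚ`-spans of log-shells
'`𝓘^ℚ((−))`' …, the log-volumes of (a) indexed by `(n,m)` are compatible — in the sense discussed in
Propositions 1.2, (iii); 1.3, (iii) — with the corresponding log-volumes indexed by `(n,m-1)`,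
relative to the log-link" (i.e. [IUTchIII] Prop. 1.2 (iii): the log-link is log-volume compatible
on the regions where it is defined — abc-iut-L6-t3). Typed over abstract data: the partial map
`lg` underlying the log-link `(n,m-1) → (n,m)` on shells and the class `Adm` of ("sufficiently
small", Remark 3.9.6) regions on which compatibility is asserted. [claim: Mochizuki2012, status: disputed] -/
def Prop39iv_b (X : ℤ → ℤ → Type u) (vol : Prop39iv_a X)
    (lg : ∀ n m, X n (m - 1) → Option (X n m)) (Adm : ∀ n m, Set (Set (X n (m - 1)))) : Prop :=
  ∀ n m, ∀ S ∈ Adm n m,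
    vol n m {y | ∃ x ∈ S, lg n m x = some y} = vol n (m - 1) S

end Global

/-! ### Remark 3.9.1: explicit integral structures -/

section Remark391

variable {K : Type u} [Field K]

/-- [IUTchIII] Remark 3.9.1 (i), p. 118: for `v_ℚ ∈ 𝕍_ℚ^non` and `k_i = K_{v_i}` the fields over `v_ℚ`,
`𝓘_i := (p*_{v_ℚ})^{-1} · log_{k_i}(𝒪^×_{k_i}) ⊆ k_i` ("`p*_{v_ℚ} = p_v` if `p_{v_ℚ}` is odd, `p²_{v_ℚ}` if even")
— this is `nonarchLogShell` / `pStar` of `LocalLogShells.lean` (abc-iut-L6-t3, [IUTchIII] Rmk 1.2.2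
(i)); the mono-analytic integral structures are `𝓘(^α𝓕_{v_ℚ}) ≅ ⊕_i 𝓘_i`, `𝓘(^A𝓕_{v_ℚ}) ≅ ⊗_α 𝓘(^α𝓕_{v_ℚ})`,
the holomorphic ones "the subrings of integers", and (last sentence) "by applying the formula of
the final display of [AbsTopIII], Proposition 5.8, (iii), for the log-volume of `𝓘_i`, one may
compute the log-volumes `μ^log_{α,v_ℚ}(𝓘(^α𝓕_{v_ℚ}))`, `μ^log_{A,v_ℚ}(𝓘(^A𝓕_{v_ℚ}))` entirely in terms of the
given initial Θ-data". Typed: the packet log-volume of the shell region `Π_i 𝓘_i` is the weighted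
sum of the summand log-volumes `c_i` supplied by [AbsTopIII] Prop. 5.8 (iii) (abc-iut-L4-t3;
[IUTchIV] Prop. 1.4 computes them) — PROVED. [claim: Mochizuki2012, status: disputed] -/
theorem Remark391i_computable {ι : Type u} [Fintype ι] {k : ι → Type v}
    [∀ i, MeasurableSpace (k i)] (w : ι → ℝ) (μ : ∀ i, Measure (k i)) (I : ∀ i, Set (k i))
    (c : ι → ℝ) (hc : ∀ i, Real.log (μ i (I i)).toReal = c i) :
    packetLogVolume w μ I = ∑ i, w i * c i := by
  simp [packetLogVolume, hc]

/-- [IUTchIII] Remark 3.9.1 (ii) (a), p. 119: "Equip `ℂ` with its standard Hermitian metric … This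
metric on `ℂ` determines a tensor product metric on `ℂ ⊗_ℝ ℂ`, as well as a direct sum metric on
`ℂ ⊕ ℂ`. Then, relative to these metrics, any isomorphism of topological rings [i.e., arising from
the Chinese remainder theorem] `ℂ ⊗_ℝ ℂ ≅ ℂ ⊕ ℂ` is compatible with these metrics, up to a factor of
`2`, i.e., the metric on the right-hand side corresponds to `2` times the metric on the left-hand
side." Typed concretely for the CRT map `z ⊗ w ↦ (zw, z w̄)` on the orthonormal basis
`{1⊗1, 1⊗i, i⊗1, i⊗i}` of `ℂ ⊗_ℝ ℂ`: the images `(1,1), (i,-i), (i,i), (-1,1)` are pairwise orthogonal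
for the real inner product `Re(a b̄) + Re(c d̄)` on `ℂ ⊕ ℂ` and each has squared norm `2` — PROVED
(the general "any isomorphism" clause reduces to this one by the classification of continuous ring
automorphisms of `ℂ ⊕ ℂ`, TODO(general form)). [claim: Mochizuki2012, status: disputed] -/
theorem Remark391ii_a_crtBasis :
    let b : Fin 4 → ℂ × ℂ := ![(1, 1), (Complex.I, -Complex.I), (Complex.I, Complex.I), (-1, 1)]
    (∀ n, Complex.normSq (b n).1 + Complex.normSq (b n).2 = 2) ∧
      ∀ n n', n ≠ n' →
        ((b n).1 * (starRingEnd ℂ) (b n').1).re + ((b n).2 * (starRingEnd ℂ) (b n').2).re = 0 := by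
  refine ⟨?_, ?_⟩
  · intro n
    fin_cases n <;> simp [Complex.normSq_apply] <;> norm_num
  · intro n n' h
    fin_cases n <;> fin_cases n' <;> simp_all

/-- [IUTchIII] Remark 3.9.1 (ii) (b), p. 119: "the direct sum decomposition `ℂ ⊕ ℂ`, together with
its Hermitian metric, is preserved … by the operation of conjugation on either of the two copies of
'ℂ' that appear in `ℂ ⊗_ℝ ℂ`, as well as by the operations of multiplying by `±1` or `±√-1` via either
of the two copies". Typed concretely: under the CRT map `z ⊗ w ↦ (zw, z w̄)`, conjugating the second
factor acts on `ℂ ⊕ ℂ` as the swap `(a, b) ↦ (b, a)` and multiplying the first factor by a unit `u`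
with `|u| = 1` acts as `(a, b) ↦ (ua, ub)`; both preserve `|a|² + |b|²` — PROVED.
[claim: Mochizuki2012, status: disputed] -/
theorem Remark391ii_b_preserved (a b u : ℂ) (hu : Complex.normSq u = 1) :
    Complex.normSq b + Complex.normSq a = Complex.normSq a + Complex.normSq b ∧
      Complex.normSq (u * a) + Complex.normSq (u * b) = Complex.normSq a + Complex.normSq b := by
  refine ⟨add_comm _ _, ?_⟩
  simp [Complex.normSq_mul, hu]

/-- The CRT identity behind Remark 3.9.1 (ii), p. 119: for the map `z ⊗ w ↦ (zw, z·w̄)`, conjugating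
`w` swaps the two components. PROVED. [claim: Mochizuki2012, status: disputed] -/
theorem Remark391ii_crt_conj_swap (z w : ℂ) :
    (z * (starRingEnd ℂ) w, z * (starRingEnd ℂ) ((starRingEnd ℂ) w)) = (z * (starRingEnd ℂ) w, z * w) := by
  simp

end Remark391

/-! ### Remarks 3.9.2, 3.9.6, 3.9.7 -/

section Remarks

/-- [IUTchIII] Remark 3.9.2, p. 119: "one may construct ['mono-analytic'] algorithms for recovering
the subquotient of the perfection of `(†𝕄⊛_mod)_α = (†𝕄⊛_MOD)_α` associated to `w ∈ 𝕍` [cf. Remark 3.6.1],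
together with the submonoid of 'nonnegative elements' …, by considering the effect of
multiplication by elements of `(†𝕄⊛_mod)_α` on the log-volumes defined on the various `𝓘^ℚ(^{A,α}𝓕_v)
≅ 𝓘^ℚ(^{A,α}𝒟^⊢_v)`". Typed: the "nonnegative elements at `w`" recovered as those whose multiplication
action does not increase the local log-volume at `w` (abstract action `act`, local log-volume
`vol`). [claim: Mochizuki2012, status: disputed] -/
def Remark392_nonnegAt {F X : Type*} (act : F → Set X → Set X) (vol : Set X → ℝ) : Set F :=
  {f | ∀ S : Set X, vol (act f S) ≤ vol S}

/-- [IUTchIII] Remark 3.9.6, p. 145: "the log-link compatibility of Proposition 3.9, (iv), implies a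
compatibility of 'product formulas', i.e., of 'ratios of conversion' between log-volumes at
distinct `v ∈ 𝕍`, in the domain and codomain of the log-link. In particular, … a compatibility between
global arithmetic degrees in the domain and codomain of the log-link." Typed over abstract data:
if two global log-volume functions (domain/codomain of the log-link) agree on a class `Adm` of
"sufficiently small" regions that is closed under the action of the number field, then invariance
under that action (the product formula) for one implies it for the other on `Adm` — PROVED.
[claim: Mochizuki2012, status: disputed] -/
theorem Remark396_productFormulaCompat {F R : Type*} (act : F → R → R) (Adm : Set R)
    (hAdm : ∀ f, ∀ S ∈ Adm, act f S ∈ Adm) (vol₁ vol₂ : R → ℝ)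
    (hagree : ∀ S ∈ Adm, vol₁ S = vol₂ S) (hinv : ∀ f S, vol₁ (act f S) = vol₁ S) :
    ∀ f, ∀ S ∈ Adm, vol₂ (act f S) = vol₂ S := by
  intro f S hS
  rw [← hagree _ (hAdm f S hS), hinv, hagree S hS]

/-- [IUTchIII] Remark 3.9.7 (i), pp. 145–146: the defining condition "zero log-volume for all but
finitely many `v_ℚ`" of `𝕄(𝓘^ℚ(^A𝓕_{𝕍_ℚ}))` "may be satisfied by considering elements … such that for all but
finitely many of the … `w_ℚ ∈ 𝕍_ℚ^non` for which `p_{w_ℚ}` is unramified in `K`, the component at `w_ℚ` is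
given by `𝓘(^A𝓕_{v_ℚ})`", since there "`𝒪(−) = 𝓘((−))` … has zero log-volume" and is "a mono-analytic
invariant … equal to its own holomorphic hull". Typed: a family of regions that equals the shell
region off a finite set, where shell regions have zero log-volume, is a global region — PROVED.
[claim: Mochizuki2012, status: disputed] -/
theorem Remark397i_shellFamily_isGlobal {VQ : Type u} {Region : VQ → Type v}
    (μlog : ∀ vQ, Region vQ → ℝ) (shell : ∀ vQ, Region vQ) (T : Finset VQ)
    (hshell : ∀ vQ, vQ ∉ T → μlog vQ (shell vQ) = 0) (S : ∀ vQ, Region vQ)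
    (hS : ∀ vQ, vQ ∉ T → S vQ = shell vQ) :
    (Function.support fun vQ => μlog vQ (S vQ)).Finite := by
  refine (T.finite_toSet).subset fun vQ hvQ => ?_
  by_contra h
  exact hvQ (by simp only [hS vQ h]; exact hshell vQ h)

/-- [IUTchIII] Remark 3.9.7 (ii), p. 146: "one may consider the log-volume of more general, say,
relatively compact subsets `E ⊆ 𝓘^ℚ((−))` … simply by defining the log-volume of `E` to be the infimum of
the log-volumes of the sets `E* ∈ 𝕄(𝓘^ℚ((−)))` such that `E ⊆ E*`. This definition means that one must
allow for the possibility that the log-volume of `E` is `−∞`." REAL definition with values in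
`EReal` (`⊥ = −∞`). [claim: Mochizuki2012, status: disputed] -/
noncomputable def logVolumeOfRelCompact {X : Type u} (M : Set (Set X)) (μlog : Set X → ℝ)
    (E : Set X) : EReal :=
  sInf ((fun Estar => ((μlog Estar : ℝ) : EReal)) '' {Estar | Estar ∈ M ∧ E ⊆ Estar})

/-- Monotonicity of the extended log-volume of Remark 3.9.7 (ii) (p. 146) in `E` — PROVED (infimum
over a smaller family). [claim: Mochizuki2012, status: disputed] -/
theorem logVolumeOfRelCompact_mono {X : Type u} (M : Set (Set X)) (μlog : Set X → ℝ)
    {E E' : Set X} (h : E ⊆ E') :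
    logVolumeOfRelCompact M μlog E ≤ logVolumeOfRelCompact M μlog E' := by
  apply sInf_le_sInf
  rintro _ ⟨Estar, ⟨hM, hE⟩, rfl⟩
  exact ⟨Estar, ⟨hM, h.trans hE⟩, rfl⟩

/-- [IUTchIII] Remark 3.9.7 (iii), pp. 146–147: for collections `{E_{v_ℚ} ⊆ 𝓘^ℚ(^A𝓕_{v_ℚ})}_{v_ℚ}` dominated
by some global region, "one may simply define the log-volume of `{E_{v_ℚ}}_{v_ℚ}` to be the infimum of
the log-volumes of the collections of sets `{E*_{v_ℚ}}_{v_ℚ}` of the sort considered in (i) such that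
`E_{v_ℚ} ⊆ E*_{v_ℚ}`, for each `v_ℚ`" (again possibly `−∞`). REAL definition over the global regions of
Proposition 3.9 (iii) (`incl` = the underlying family of subsets of a global region).
[claim: Mochizuki2012, status: disputed] -/
noncomputable def globalLogVolumeOfCollection {VQ : Type u} {Region : VQ → Type v}
    {X : VQ → Type v} (μlog : ∀ vQ, Region vQ → ℝ) (incl : ∀ vQ, Region vQ → Set (X vQ))
    (E : ∀ vQ, Set (X vQ)) : EReal :=
  sInf ((fun S : GlobalRegion μlog => ((globalLogVolume μlog S : ℝ) : EReal)) ''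
    {S | ∀ vQ, E vQ ⊆ incl vQ (S.1 vQ)})

end Remarks

end Literature.IUT.LogThetaLattice
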